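import Literature.RepresentationTheory.FiniteGroups.OctopusInequality
import HarnessLib

/-!
# The Caputo–Liggett–Richthammer theorem: the interchange process has the random-walk gap

Topic `Literature/RepresentationTheory/FiniteGroups`. Caputo, Liggett, Richthammer, *Proof of Aldous'
spectral gap conjecture*, J. Amer. Math. Soc. 23 (2010), Theorem 1.1: for every weighted graph the
interchange process and the random walk have the same spectral gap. The non-trivial inequality
`λ₁^{IP} ≥ λ₁^{RW}` is PROVED here in Dirichlet-form language (CLR (gap1), §2.3):

`clr_spectralGap : ∀ A ≥ 0, ∀ f : 𝔖ₙ → ℂ with ∑ f = 0, λ₁^{RW}(A) · ‖f‖² ≤ 𝓔_A(f)`,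

where `𝓔_A(f) = ½ ∑_{x<y} a_{xy} ∑_τ ‖f((xy)τ) − f(τ)‖² = Re⟪f, L_A f⟫` is the Dirichlet form of the
interchange Laplacian of `AldousLambdaOne.lean` (`re_l2Inner_interchangeLaplacian`) and
`λ₁^{RW}(A) = inf {𝓔^{RW}_A(φ)/‖φ‖² : ∑ φ = 0, φ ≠ 0}`, `𝓔^{RW}_A(φ) = ∑_{x<y} a_{xy}‖φ(x) − φ(y)‖²`, is
the random-walk gap (CLR (gap1)). This file declares THEOREMS ONLY: the Dirichlet forms, the gap,
the site sums `N_f(x,i) = ∑_{τ i = x} f(τ)` and the one-particle superpositions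
`G_M(τ) = ∑_i M(τ i, i)` are written out in full in every statement.
The proof is CLR's recursion (§2.4) on the number of vertices, reducing at the vertex `0`:

* `rwDirichlet_cons_harmonic` (CLR Lemma 2.2 with `Lg(x) = 0`) and `gapRW_le_gapRW_red`
  (CLR Prop. 2.1, proved variationally through the harmonic extension instead of the
  `L² + λL ≥ 0` characterisation): the random-walk gap of the reduced network
  `ã_{yz} = a_{y⁺z⁺} + a_{0y⁺}a_{0z⁺}/∑_w a_{0w⁺}` (CLR (redrates)) is at least that of `A`;
* `sum_ipDirichlet_blocks_le` (CLR Prop. 2.4, first half): by the octopus inequality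
  (`octopus_inequality`), `𝓔_A(f) ≥ ∑_p 𝓔^{(m)}_{Ã}(f ∘ blockEmb p)`, the blocks being the cosets
  `{τ | τ p = 0}` ("for a fixed value of `η_x`");
* the subspace `𝓗 = {f | ν[f | η_x = i] = 0 ∀ x i}` of CLR §2.3 is `{f | N_f = 0}`; instead of the
  eigenvector argument of §2.3 we split any `f ⊥ 1` ORTHOGONALLY as `f = h + g` with `h ∈ 𝓗` and
  `g = G_M`, `M = N_f/κ`, a superposition of one-particle functions (`exists_decomp`), for which
  `𝓔_A(g) ≥ λ₁^{RW}‖g‖²` directly (`gapRW_mul_le_ipDirichlet_tensorFun`), while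
  `𝓔_A(h) ≥ λ₁^{RW}‖h‖²` by the two previous items and the induction hypothesis (block means of `h`
  vanish);
* base cases `n ≤ 2` ("when `n = 2` the random walk and the interchange process are the same
  2-state Markov chain").

## References

* P. Caputo, T. M. Liggett, T. Richthammer, *Proof of Aldous' spectral gap conjecture*, J. Amer.
  Math. Soc. 23 (2010) 831–851, arXiv:0906.1238: Thm 1.1, Prop. 2.1, Lemma 2.2, Thm 2.3, §2.3–2.4.
  [CaputoLiggettRichthammer2010]

## Mathlib and tree

Mathlib: `Real.sInf_nonneg`, `csInf_le`, `le_csInf`, `Fin.cons`, `Fin.sum_univ_succ`,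
`Fintype.sum_eq_add`. Tree: `InterchangeDirichletForm.lean` (`l2Inner`, `transpDirichlet`,
`sum_perm_apply_eq`, `sum_perm_apply_apply_eq`, `blockEmb`, `sum_filter_apply_eq_zero`,
`transpDirichlet_succ_succ`), `OctopusInequality.lean` (`octopus_inequality`,
`Octopus.sum_sum_eq_sum_prs`), `AldousLambdaOne.lean` (`interchangeLaplacian_apply`).
-/

noncomputable section

open scoped BigOperators ComplexConjugate
open Equiv Finset

namespace Literature.RepresentationTheory.FiniteGroups

/-! ### The random walk: Dirichlet form `𝓔^{RW}_A(φ) = ∑_{x<y} a_{xy}‖φ x − φ y‖²` and spectral gap -/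

section RandomWalk

variable {n : ℕ}

/-- `𝓔^{RW} ≥ 0` for non-negative rates (CLR §1.1: `−𝓛` is positive semi-definite).
[cite: CaputoLiggettRichthammer2010, §1.1] -/
theorem rwDirichlet_nonneg {A : Fin n → Fin n → ℝ} (hA : ∀ x y, 0 ≤ A x y) (φ : Fin n → ℂ) :
    0 ≤ (∑ x : Fin n, ∑ y : Fin n with x < y, A x y * ‖φ x - φ y‖ ^ 2) :=
  Finset.sum_nonneg fun x _ => Finset.sum_nonneg fun y _ => mul_nonneg (hA x y) (by positivity)

/-- The Dirichlet form only sees differences. [folklore] -/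
theorem rwDirichlet_sub_const (A : Fin n → Fin n → ℝ) (φ : Fin n → ℂ) (c : ℂ) :
    (∑ x : Fin n, ∑ y : Fin n with x < y, A x y * ‖(φ x - c) - (φ y - c)‖ ^ 2) = (∑ x : Fin n, ∑ y : Fin n with x < y, A x y * ‖φ x - φ y‖ ^ 2) := by
  simp only [sub_sub_sub_cancel_right]

/-- **`λ₁^{RW} ≥ 0`**, for the spectral gap of the random walk
`λ₁^{RW}(A) = inf {𝓔^{RW}_A(φ)/‖φ‖² : ∑ φ = 0, φ ≠ 0}` (CLR (gap1): "the largest constant `λ` such that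
`½∑ q_{ij}(g(j)−g(i))² ≥ λ ∑ g(i)²` for all `g` with `∑ g(i) = 0`"; junk value `sInf ∅ = 0` when
`n ≤ 1`). [cite: CaputoLiggettRichthammer2010, §1.1 (gap1)] -/
theorem gapRW_nonneg {A : Fin n → Fin n → ℝ} (hA : ∀ x y, 0 ≤ A x y) :
    0 ≤ sInf ((fun φ : Fin n → ℂ => (∑ x : Fin n, ∑ y : Fin n with x < y, A x y * ‖φ x - φ y‖ ^ 2) / l2NormSq φ) '' {φ : Fin n → ℂ | ∑ x, φ x = 0 ∧ φ ≠ 0}) := by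
  refine Real.sInf_nonneg ?_
  rintro _ ⟨φ, -, rfl⟩
  exact div_nonneg (rwDirichlet_nonneg hA φ) (l2NormSq_nonneg φ)

/-- `λ₁^{RW}` is below every admissible Rayleigh quotient. [cite: CaputoLiggettRichthammer2010, §1.1 (gap1)] -/
theorem gapRW_le {A : Fin n → Fin n → ℝ} (hA : ∀ x y, 0 ≤ A x y) {φ : Fin n → ℂ} (hφ : ∑ x, φ x = 0)
    (hφ0 : φ ≠ 0) :
    sInf ((fun φ : Fin n → ℂ => (∑ x : Fin n, ∑ y : Fin n with x < y, A x y * ‖φ x - φ y‖ ^ 2) / l2NormSq φ) '' {φ : Fin n → ℂ | ∑ x, φ x = 0 ∧ φ ≠ 0}) ≤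
      (∑ x : Fin n, ∑ y : Fin n with x < y, A x y * ‖φ x - φ y‖ ^ 2) / l2NormSq φ := by
  refine csInf_le ⟨0, ?_⟩ ⟨φ, ⟨hφ, hφ0⟩, rfl⟩
  rintro _ ⟨ψ, -, rfl⟩
  exact div_nonneg (rwDirichlet_nonneg hA ψ) (l2NormSq_nonneg ψ)

/-- **The gap inequality** `λ₁^{RW} ‖φ‖² ≤ 𝓔^{RW}(φ)` for `∑ φ = 0`. [cite: CaputoLiggettRichthammer2010, §1.1 (gap1)] -/
theorem gapRW_mul_le {A : Fin n → Fin n → ℝ} (hA : ∀ x y, 0 ≤ A x y) {φ : Fin n → ℂ} (hφ : ∑ x, φ x = 0) :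
    sInf ((fun φ : Fin n → ℂ => (∑ x : Fin n, ∑ y : Fin n with x < y, A x y * ‖φ x - φ y‖ ^ 2) / l2NormSq φ) '' {φ : Fin n → ℂ | ∑ x, φ x = 0 ∧ φ ≠ 0}) * l2NormSq φ ≤
      (∑ x : Fin n, ∑ y : Fin n with x < y, A x y * ‖φ x - φ y‖ ^ 2) := by
  by_cases hφ0 : φ = 0
  · subst hφ0
    rw [l2NormSq_zero, mul_zero]
    exact rwDirichlet_nonneg hA 0
  · rw [← le_div_iff₀ ((l2NormSq_pos_iff φ).mpr hφ0)]
    exact gapRW_le hA hφ hφ0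

/-- A lower bound for all admissible Rayleigh quotients is below the gap (`n ≥ 2`).
[cite: CaputoLiggettRichthammer2010, §1.1 (gap1)] -/
theorem le_gapRW (hn : 2 ≤ n) {A : Fin n → Fin n → ℝ} {t : ℝ}
    (h : ∀ φ : Fin n → ℂ, ∑ x, φ x = 0 → φ ≠ 0 →
      t ≤ (∑ x : Fin n, ∑ y : Fin n with x < y, A x y * ‖φ x - φ y‖ ^ 2) / l2NormSq φ) :
    t ≤ sInf ((fun φ : Fin n → ℂ => (∑ x : Fin n, ∑ y : Fin n with x < y, A x y * ‖φ x - φ y‖ ^ 2) / l2NormSq φ) '' {φ : Fin n → ℂ | ∑ x, φ x = 0 ∧ φ ≠ 0}) := by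
  have h0 : 0 < n := by omega
  have h1 : 1 < n := by omega
  -- the admissible function `δ₀ − δ₁`
  set φ : Fin n → ℂ := fun x => if x = ⟨0, h0⟩ then 1 else if x = ⟨1, h1⟩ then -1 else 0 with hφ
  have hne : (⟨0, h0⟩ : Fin n) ≠ ⟨1, h1⟩ := by simp
  have hφsum : ∑ x, φ x = 0 := by
    rw [Fintype.sum_eq_add (⟨0, h0⟩ : Fin n) ⟨1, h1⟩ hne]
    · simp [hφ]
    · intro x hx
      simp [hφ, hx.1, hx.2]
  have hφ0 : φ ≠ 0 := by
    intro h
    have := congrFun h ⟨0, h0⟩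
    simp [hφ] at this
  exact le_csInf ⟨_, φ, ⟨hφsum, hφ0⟩, rfl⟩ (by rintro _ ⟨ψ, ⟨hψ, hψ0⟩, rfl⟩; exact h ψ hψ hψ0)

/-- **An isolated vertex kills the gap**: if vertex `0` carries no rate then `λ₁^{RW}(A) = 0` (`n ≥ 2`).
[folklore] -/
theorem gapRW_eq_zero_of_isolated {m : ℕ} (hm : 1 ≤ m) {A : Fin (m + 1) → Fin (m + 1) → ℝ}
    (hA : ∀ x y, 0 ≤ A x y) (h0 : ∀ y : Fin m, A 0 y.succ = 0) :
    sInf ((fun φ : Fin (m + 1) → ℂ => (∑ x : Fin (m + 1), ∑ y : Fin (m + 1) with x < y, A x y * ‖φ x - φ y‖ ^ 2) / l2NormSq φ) '' {φ : Fin (m + 1) → ℂ | ∑ x, φ x = 0 ∧ φ ≠ 0}) = 0 := by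
  refine le_antisymm ?_ (gapRW_nonneg hA)
  -- test function `φ 0 = m`, `φ y⁺ = -1`
  set φ : Fin (m + 1) → ℂ := Fin.cons (m : ℂ) (fun _ => -1) with hφ
  have hφsum : ∑ x, φ x = 0 := by
    rw [Fin.sum_univ_succ]
    simp [hφ]
  have hφ0 : φ ≠ 0 := by
    intro h
    have := congrFun h (Fin.succ ⟨0, hm⟩)
    rw [hφ, Fin.cons_succ, Pi.zero_apply] at this
    norm_num at this
  have hD : (∑ x : Fin (m + 1), ∑ y : Fin (m + 1) with x < y, A x y * ‖φ x - φ y‖ ^ 2) = 0 := by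
    rw [Fin.sum_univ_succ]
    have h1 : ∑ y : Fin (m + 1) with (0 : Fin (m + 1)) < y, A 0 y * ‖φ 0 - φ y‖ ^ 2 = 0 := by
      rw [Finset.sum_filter, Fin.sum_univ_succ, if_neg (lt_irrefl _), zero_add]
      refine Finset.sum_eq_zero fun y _ => ?_
      rw [h0 y]
      simp
    have h2 : ∀ i : Fin m, ∑ y : Fin (m + 1) with i.succ < y, A i.succ y * ‖φ i.succ - φ y‖ ^ 2 = 0 := by
      intro i
      rw [Finset.sum_filter, Fin.sum_univ_succ, if_neg (Fin.not_lt.mpr (Fin.zero_le _)), zero_add]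
      refine Finset.sum_eq_zero fun y _ => ?_
      simp [hφ]
    rw [h1, zero_add]
    exact Finset.sum_eq_zero fun i _ => h2 i
  have := gapRW_le hA hφsum hφ0
  rwa [hD, zero_div] at this

end RandomWalk

/-! ### The interchange Dirichlet form `𝓔_A(f) = ½ ∑_{x<y} a_{xy} ∑_τ ‖f((xy)τ) − f(τ)‖²` -/

section Interchange

variable {n : ℕ}

/-- `𝓔_A(f) = Re⟪f, L_A f⟫` (`re_l2Inner_interchangeLaplacian`; `(n!)·` CLR's
`𝓔(f) = ½∑_b c_b ν[(∇_b f)²]`). [cite: CaputoLiggettRichthammer2010, §2.3] -/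
theorem ipDirichlet_eq_re (A : Fin n → Fin n → ℝ) (f : Perm (Fin n) → ℂ) :
    (∑ x : Fin n, ∑ y : Fin n with x < y, A x y * (transpDirichlet x y f / 2)) = (l2Inner f (interchangeLaplacian n A f)).re :=
  (re_l2Inner_interchangeLaplacian A f).symm

/-- `𝓔_A ≥ 0`. [cite: CaputoLiggettRichthammer2010, §1.1] -/
theorem ipDirichlet_nonneg {A : Fin n → Fin n → ℝ} (hA : ∀ x y, 0 ≤ A x y) (f : Perm (Fin n) → ℂ) :
    0 ≤ (∑ x : Fin n, ∑ y : Fin n with x < y, A x y * (transpDirichlet x y f / 2)) :=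
  Finset.sum_nonneg fun x _ => Finset.sum_nonneg fun y _ =>
    mul_nonneg (hA x y) (div_nonneg (transpDirichlet_nonneg x y f) (by norm_num))

/-- `𝓔_A(f − c) = 𝓔_A(f)`. [folklore] -/
theorem ipDirichlet_sub_const (A : Fin n → Fin n → ℝ) (f : Perm (Fin n) → ℂ) (c : ℂ) :
    (∑ x : Fin n, ∑ y : Fin n with x < y, A x y * (transpDirichlet x y (fun τ => f τ - c) / 2)) = (∑ x : Fin n, ∑ y : Fin n with x < y, A x y * (transpDirichlet x y f / 2)) := by
  simp only [transpDirichlet_sub_const]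

/-- `⟪u, L_A w⟫ = ∑_{x<y} a_{xy} ⟪u, w − w((xy)·)⟫`. [cite: CaputoLiggettRichthammer2010, §2.3] -/
theorem l2Inner_interchangeLaplacian' (A : Fin n → Fin n → ℝ) (u w : Perm (Fin n) → ℂ) :
    l2Inner u (interchangeLaplacian n A w) =
      ∑ x : Fin n, ∑ y : Fin n with x < y, ((A x y : ℝ) : ℂ) * l2Inner u (w - fun τ => w (swap x y * τ)) := by
  unfold l2Inner
  simp_rw [interchangeLaplacian_apply, Finset.mul_sum]
  rw [Finset.sum_comm]
  refine Finset.sum_congr rfl fun x _ => ?_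
  rw [Finset.sum_comm]
  refine Finset.sum_congr rfl fun y _ => Finset.sum_congr rfl fun τ _ => ?_
  simp only [Pi.sub_apply]
  ring

/-- **`L_A` is self-adjoint**: `⟪a, L_A b⟫ = ⟪L_A a, b⟫`. [cite: CaputoLiggettRichthammer2010, §1.1] -/
theorem l2Inner_interchangeLaplacian_comm (A : Fin n → Fin n → ℝ) (a b : Perm (Fin n) → ℂ) :
    l2Inner a (interchangeLaplacian n A b) = l2Inner (interchangeLaplacian n A a) b := by
  rw [l2Inner_interchangeLaplacian', ← conj_l2Inner b, l2Inner_interchangeLaplacian', map_sum]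
  refine Finset.sum_congr rfl fun x _ => ?_
  rw [map_sum]
  refine Finset.sum_congr rfl fun y _ => ?_
  rw [map_mul, Complex.conj_ofReal, l2Inner_sub_right, l2Inner_sub_right, map_sub, conj_l2Inner,
    conj_l2Inner_shift_of_mul_self _ _ (swap_mul_self x y)]

end Interchange

/-! ### Site sums `N_f(x,i) = ∑_{τ : τ i = x} f(τ)` and one-particle superpositions `G_M(τ) = ∑_i M(τ i, i)` -/

section SiteSum

variable {n : ℕ}

/-- Row sums of the site sums (`(n−1)!·ν[f | ξ_i = x]`, CLR §2.3): `∑_i N_f(x,i) = ∑_τ f(τ)`.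
[cite: CaputoLiggettRichthammer2010, §2.3] -/
theorem sum_siteSum_right (f : Perm (Fin n) → ℂ) (x : Fin n) :
    ∑ i, ∑ ω : Perm (Fin n) with ω i = x, f ω = ∑ τ, f τ := by
  simp_rw [Finset.sum_filter]
  rw [Finset.sum_comm]
  refine Finset.sum_congr rfl fun τ _ => ?_
  have : ∀ i, (τ i = x) ↔ (i = τ.symm x) := fun i => by
    rw [Equiv.eq_symm_apply]
  simp_rw [this]
  rw [Finset.sum_ite_eq']
  simp

/-- Column sums: `∑_x N_f(x,i) = ∑_τ f(τ)`. [folklore] -/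
theorem sum_siteSum_left (f : Perm (Fin n) → ℂ) (i : Fin n) :
    ∑ x, ∑ ω : Perm (Fin n) with ω i = x, f ω = ∑ τ, f τ := by
  simp_rw [Finset.sum_filter]
  rw [Finset.sum_comm]
  refine Finset.sum_congr rfl fun τ _ => ?_
  rw [Finset.sum_ite_eq]
  simp

/-- Site sums of a shifted function. [folklore] -/
theorem siteSum_shift (f : Perm (Fin n) → ℂ) (s : Perm (Fin n)) (x i : Fin n) :
    ∑ τ : Perm (Fin n) with τ i = x, f (s * τ) = ∑ ω : Perm (Fin n) with ω i = s x, f ω := by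
  rw [Finset.sum_filter, Finset.sum_filter]
  refine Fintype.sum_equiv (Equiv.mulLeft s) _ _ fun τ => ?_
  simp only [Equiv.coe_mulLeft, Perm.mul_apply]
  by_cases h : τ i = x
  · rw [if_pos h, if_pos (by rw [h])]
  · rw [if_neg h, if_neg (fun h' => h (s.injective h'))]

/-- **`𝓗` is invariant under `L_A`**: if all site sums of `h` vanish then so do those of `L_A h`
(CLR §2.3: "`𝓗` is an invariant subspace for `−𝓛^{IP}`"). [cite: CaputoLiggettRichthammer2010, §2.3] -/
theorem siteSum_interchangeLaplacian_eq_zero (A : Fin n → Fin n → ℝ) {h : Perm (Fin n) → ℂ}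
    (hh : ∀ x i, ∑ ω : Perm (Fin n) with ω i = x, h ω = 0) (x i : Fin n) :
    ∑ ω : Perm (Fin n) with ω i = x, interchangeLaplacian n A h ω = 0 := by
  simp_rw [interchangeLaplacian_apply]
  rw [Finset.sum_comm]
  refine Finset.sum_eq_zero fun u _ => ?_
  rw [Finset.sum_comm]
  refine Finset.sum_eq_zero fun v _ => ?_
  rw [← Finset.mul_sum, Finset.sum_sub_distrib, hh, siteSum_shift, hh, sub_zero, mul_zero]

/-- **Adjunction** `⟪G_M, u⟫ = ∑_{x,i} conj M(x,i) · N_u(x,i)` for the one-particle superposition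
`G_M(τ) = ∑_i M(τ i, i)`. [folklore] -/
theorem l2Inner_tensorFun (M : Fin n → Fin n → ℂ) (u : Perm (Fin n) → ℂ) :
    l2Inner (fun τ : Perm (Fin n) => ∑ i, M (τ i) i) u = ∑ x, ∑ i, conj (M x i) * ∑ ω : Perm (Fin n) with ω i = x, u ω := by
  rw [l2Inner, Finset.sum_comm]
  simp_rw [map_sum, Finset.sum_mul]
  rw [Finset.sum_comm]
  refine Finset.sum_congr rfl fun i _ => ?_
  -- fibre over `τ i`
  rw [← Finset.sum_fiberwise_of_maps_to (g := fun τ : Perm (Fin n) => τ i) (t := Finset.univ)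
    (fun _ _ => Finset.mem_univ _)]
  refine Finset.sum_congr rfl fun x _ => ?_
  rw [Finset.mul_sum]
  refine Finset.sum_congr rfl fun τ hτ => ?_
  rw [(Finset.mem_filter.mp hτ).2]

/-- `κ_n = (n−1)! + (n−2)! > 0`. [folklore] -/
theorem kappa_pos (n : ℕ) : (0 : ℝ) < ((n - 1).factorial + (n - 2).factorial : ℕ) := by
  exact_mod_cast Nat.add_pos_left (Nat.factorial_pos _) _

/-- **`N_{G_M} = κ M` for doubly centred `M`** (rows and columns of `M` summing to zero),
`κ = (n−1)! + (n−2)!`. [folklore] -/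
theorem siteSum_tensorFun {M : Fin n → Fin n → ℂ} (hrow : ∀ x, ∑ i, M x i = 0) (hcol : ∀ i, ∑ x, M x i = 0)
    (x i : Fin n) :
    ∑ ω : Perm (Fin n) with ω i = x, (∑ j, M (ω j) j) = ((((n - 1).factorial + (n - 2).factorial : ℕ) : ℝ) : ℂ) * M x i := by
  classical
  rw [Finset.sum_filter]
  -- exchange the sums
  have : ∑ τ : Perm (Fin n), (if τ i = x then ∑ j, M (τ j) j else 0) =
      ∑ j, ∑ τ : Perm (Fin n), if τ i = x then M (τ j) j else 0 := by
    rw [Finset.sum_comm]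
    refine Finset.sum_congr rfl fun τ _ => ?_
    split_ifs <;> simp
  rw [this, ← Finset.add_sum_erase _ _ (Finset.mem_univ i)]
  -- the term `j = i`
  have hdiag : ∑ τ : Perm (Fin n), (if τ i = x then M (τ i) i else 0) = ((n - 1).factorial : ℂ) * M x i := by
    have := sum_perm_apply_eq (fun y => if y = x then M y i else 0) i
    rw [this, Finset.sum_ite_eq', if_pos (Finset.mem_univ _), Fintype.card_fin, nsmul_eq_mul]
  -- the terms `j ≠ i`
  have hoff : ∀ j ∈ Finset.univ.erase i,
      ∑ τ : Perm (Fin n), (if τ i = x then M (τ j) j else 0) = -(((n - 2).factorial : ℂ) * M x j) := by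
    intro j hj
    have hij : i ≠ j := (Finset.ne_of_mem_erase hj).symm
    have := sum_perm_apply_apply_eq (fun a b => if a = x then M b j else 0) hij
    rw [this, Fintype.card_fin, nsmul_eq_mul]
    have hinner : ∑ a, ∑ b ∈ Finset.univ.filter (fun b => b ≠ a), (if a = x then M b j else 0) =
        ∑ b ∈ Finset.univ.filter (fun b => b ≠ x), M b j := by
      rw [Finset.sum_eq_single x]
      · simp
      · intro a _ hax
        simp [hax]
      · simp
    rw [hinner, Finset.filter_ne', Finset.sum_erase_eq_sub (Finset.mem_univ x), hcol, zero_sub, mul_neg]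
  rw [hdiag, Finset.sum_congr rfl hoff, Finset.sum_neg_distrib, ← Finset.mul_sum,
    Finset.sum_erase_eq_sub (Finset.mem_univ i), hrow, zero_sub, mul_neg, neg_neg]
  push_cast
  ring

/-- **`‖G_D‖² = κ ∑ ‖D‖²`** for doubly centred `D`. [folklore] -/
theorem l2NormSq_tensorFun {D : Fin n → Fin n → ℂ} (hrow : ∀ x, ∑ i, D x i = 0) (hcol : ∀ i, ∑ x, D x i = 0) :
    l2NormSq (fun τ : Perm (Fin n) => ∑ i, D (τ i) i) = ((n - 1).factorial + (n - 2).factorial : ℕ) * ∑ x, ∑ i, ‖D x i‖ ^ 2 := by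
  rw [← l2Inner_self_re, l2Inner_tensorFun]
  simp_rw [siteSum_tensorFun hrow hcol]
  rw [Complex.re_sum, Finset.mul_sum]
  refine Finset.sum_congr rfl fun x _ => ?_
  rw [Complex.re_sum, Finset.mul_sum]
  refine Finset.sum_congr rfl fun i _ => ?_
  rw [mul_left_comm, Complex.re_ofReal_mul, Complex.conj_mul', ← Complex.ofReal_pow, Complex.ofReal_re]

/-- The difference matrix `D(x,i) = M((uv)x, i) − M(x, i)` is doubly centred if `M` has zero row sums.
[folklore] -/
theorem shiftDiff_centred (M : Fin n → Fin n → ℂ) (hrow : ∀ x, ∑ i, M x i = 0) (s : Perm (Fin n)) :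
    (∀ x, ∑ i, (M (s x) i - M x i) = 0) ∧ (∀ i, ∑ x, (M (s x) i - M x i) = 0) := by
  refine ⟨fun x => by rw [Finset.sum_sub_distrib, hrow, hrow, sub_self], fun i => ?_⟩
  rw [Finset.sum_sub_distrib, sub_eq_zero]
  exact Fintype.sum_equiv s _ _ fun x => rfl

/-- `∑_x ‖M((uv)x,i) − M(x,i)‖² = 2‖M(u,i) − M(v,i)‖²`. [folklore] -/
theorem sum_norm_shiftDiff (M : Fin n → Fin n → ℂ) {u v : Fin n} (huv : u ≠ v) (i : Fin n) :
    ∑ x, ‖M (swap u v x) i - M x i‖ ^ 2 = 2 * ‖M u i - M v i‖ ^ 2 := by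
  rw [Fintype.sum_eq_add u v huv]
  · rw [swap_apply_left, swap_apply_right, norm_sub_rev (M v i)]
    ring
  · intro x hx
    rw [swap_apply_of_ne_of_ne hx.1 hx.2, sub_self, norm_zero]
    simp

/-- **The Dirichlet form of a one-particle superposition** (doubly centred `M`):
`𝓔_A(G_M) = κ ∑_i 𝓔^{RW}_A(M(·, i))` — each particle performs the random walk
(the intertwining (mcprojection) of CLR §1.1). [cite: CaputoLiggettRichthammer2010, §1.2.2 (mcprojection)] -/
theorem ipDirichlet_tensorFun {A : Fin n → Fin n → ℝ} {M : Fin n → Fin n → ℂ}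
    (hrow : ∀ x, ∑ i, M x i = 0) :
    (∑ x : Fin n, ∑ y : Fin n with x < y, A x y * (transpDirichlet x y (fun τ : Perm (Fin n) => ∑ i, M (τ i) i) / 2)) =
      ((n - 1).factorial + (n - 2).factorial : ℕ) * ∑ i, (∑ x : Fin n, ∑ y : Fin n with x < y, A x y * ‖M x i - M y i‖ ^ 2) := by
  have hT : ∀ u v : Fin n, u < v → transpDirichlet u v (fun τ : Perm (Fin n) => ∑ i, M (τ i) i) / 2 =
      ((n - 1).factorial + (n - 2).factorial : ℕ) * ∑ i, ‖M u i - M v i‖ ^ 2 := by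
    intro u v huv
    have hD := shiftDiff_centred M hrow (swap u v)
    rw [transpDirichlet_eq_l2NormSq]
    have : ((fun τ => (fun τ : Perm (Fin n) => ∑ i, M (τ i) i) (swap u v * τ)) - (fun τ : Perm (Fin n) => ∑ i, M (τ i) i)) =
        (fun τ : Perm (Fin n) => ∑ i, (fun x i => M (swap u v x) i - M x i) (τ i) i) := by
      funext τ
      simp only [Pi.sub_apply, Perm.mul_apply, Finset.sum_sub_distrib]
    rw [this, l2NormSq_tensorFun hD.1 hD.2, Finset.sum_comm]
    simp_rw [sum_norm_shiftDiff M huv.ne]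
    rw [← Finset.mul_sum]
    ring
  -- normalise the right-hand side
  have hR : ((n - 1).factorial + (n - 2).factorial : ℕ) * ∑ i, ∑ x : Fin n, ∑ y : Fin n with x < y, A x y * ‖M x i - M y i‖ ^ 2 =
      ∑ x : Fin n, ∑ y : Fin n with x < y, ∑ i, ((n - 1).factorial + (n - 2).factorial : ℕ) * (A x y * ‖M x i - M y i‖ ^ 2) := by
    rw [Finset.mul_sum]
    simp_rw [Finset.mul_sum]
    rw [Finset.sum_comm]
    refine Finset.sum_congr rfl fun x _ => ?_
    rw [Finset.sum_comm]
  rw [hR]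
  refine Finset.sum_congr rfl fun x _ => Finset.sum_congr rfl fun y hy => ?_
  rw [hT x y (Finset.mem_filter.mp hy).2, Finset.mul_sum, Finset.mul_sum]
  exact Finset.sum_congr rfl fun i _ => by ring

/-- **`‖G_M‖² = κ ∑_i ‖M(·,i)‖²`** for doubly centred `M`. [folklore] -/
theorem l2NormSq_tensorFun_eq_sum {M : Fin n → Fin n → ℂ} (hrow : ∀ x, ∑ i, M x i = 0)
    (hcol : ∀ i, ∑ x, M x i = 0) :
    l2NormSq (fun τ : Perm (Fin n) => ∑ i, M (τ i) i) = ((n - 1).factorial + (n - 2).factorial : ℕ) * ∑ i, l2NormSq (fun x => M x i) := by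
  rw [l2NormSq_tensorFun hrow hcol, Finset.sum_comm]
  rfl

/-- **The random-walk gap bounds one-particle superpositions**:
`λ₁^{RW} · ‖G_M‖² ≤ 𝓔_A(G_M)` for doubly centred `M` (each column of `M` is an admissible test
function; CLR §2.3: eigenfunctions outside `𝓗` come from random-walk eigenfunctions).
[cite: CaputoLiggettRichthammer2010, §2.3] -/
theorem gapRW_mul_le_ipDirichlet_tensorFun {A : Fin n → Fin n → ℝ} (hA : ∀ x y, 0 ≤ A x y)
    {M : Fin n → Fin n → ℂ} (hrow : ∀ x, ∑ i, M x i = 0) (hcol : ∀ i, ∑ x, M x i = 0) :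
    sInf ((fun φ : Fin n → ℂ => (∑ x : Fin n, ∑ y : Fin n with x < y, A x y * ‖φ x - φ y‖ ^ 2) / l2NormSq φ) '' {φ : Fin n → ℂ | ∑ x, φ x = 0 ∧ φ ≠ 0}) *
        l2NormSq (fun τ : Perm (Fin n) => ∑ i, M (τ i) i) ≤
      (∑ x : Fin n, ∑ y : Fin n with x < y, A x y * (transpDirichlet x y (fun τ : Perm (Fin n) => ∑ i, M (τ i) i) / 2)) := by
  rw [ipDirichlet_tensorFun hrow, l2NormSq_tensorFun_eq_sum hrow hcol, mul_left_comm, Finset.mul_sum,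
    Finset.mul_sum, Finset.mul_sum]
  refine Finset.sum_le_sum fun i _ => ?_
  exact mul_le_mul_of_nonneg_left (gapRW_mul_le hA (hcol i)) (kappa_pos n).le

end SiteSum

/-! ### The orthogonal decomposition `f = h + g`, `h ∈ 𝓗`, `g` a one-particle superposition -/

section Decomposition

variable {n : ℕ}

/-- **The orthogonal decomposition.** Every `f : 𝔖ₙ → ℂ` with `∑ f = 0` splits as `f = h + g` with
`h ∈ 𝓗` (all site sums vanish: `∑_{τ i = x} h(τ) = 0`), `g = G_M` the one-particle superposition with
`M = N_f/κ`, `‖f‖² = ‖h‖² + ‖g‖²`, `𝓔_A(f) = 𝓔_A(h) + 𝓔_A(g)` (`⟪g, h⟫ = ⟪g, L_A h⟫ = 0` as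
`N_h = 0`, `N_{L_A h} = 0`), and `λ₁^{RW} ‖g‖² ≤ 𝓔_A(g)` (CLR §2.3: `𝓗` and its complement, which is
spanned by one-particle functions, are invariant; here without eigenvectors).
[cite: CaputoLiggettRichthammer2010, §2.3] -/
theorem exists_decomp (A : Fin n → Fin n → ℝ) (hA : ∀ x y, 0 ≤ A x y) (f : Perm (Fin n) → ℂ)
    (hf : ∑ τ, f τ = 0) :
    ∃ h g : Perm (Fin n) → ℂ, f = h + g ∧
      l2NormSq f = l2NormSq h + l2NormSq g ∧
      (∑ x : Fin n, ∑ y : Fin n with x < y, A x y * (transpDirichlet x y f / 2)) =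
        (∑ x : Fin n, ∑ y : Fin n with x < y, A x y * (transpDirichlet x y h / 2)) +
          (∑ x : Fin n, ∑ y : Fin n with x < y, A x y * (transpDirichlet x y g / 2)) ∧
      sInf ((fun φ : Fin n → ℂ => (∑ x : Fin n, ∑ y : Fin n with x < y, A x y * ‖φ x - φ y‖ ^ 2) / l2NormSq φ) '' {φ : Fin n → ℂ | ∑ x, φ x = 0 ∧ φ ≠ 0}) * l2NormSq g ≤
        (∑ x : Fin n, ∑ y : Fin n with x < y, A x y * (transpDirichlet x y g / 2)) ∧
      ∀ x i : Fin n, ∑ ω : Perm (Fin n) with ω i = x, h ω = 0 := by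
  -- `M = N_f/κ`, `g = G_M`, `h = f - g`
  set κ : ℂ := ((((n - 1).factorial + (n - 2).factorial : ℕ) : ℝ) : ℂ) with hκ
  have hκ0 : κ ≠ 0 := Complex.ofReal_ne_zero.mpr (kappa_pos n).ne'
  set M : Fin n → Fin n → ℂ := fun x i => (∑ ω : Perm (Fin n) with ω i = x, f ω) / κ with hM
  set g : Perm (Fin n) → ℂ := fun τ => ∑ i, M (τ i) i with hg
  set h : Perm (Fin n) → ℂ := f - g with hh
  have hrow : ∀ x, ∑ i, M x i = 0 := fun x => by
    simp only [hM]
    rw [← Finset.sum_div, sum_siteSum_right, hf, zero_div]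
  have hcol : ∀ i, ∑ x, M x i = 0 := fun i => by
    simp only [hM]
    rw [← Finset.sum_div, sum_siteSum_left, hf, zero_div]
  -- `h ∈ 𝓗`
  have hsite : ∀ x i : Fin n, ∑ ω : Perm (Fin n) with ω i = x, h ω = 0 := by
    intro x i
    simp only [hh, Pi.sub_apply, Finset.sum_sub_distrib]
    rw [hg]
    rw [siteSum_tensorFun hrow hcol, ← hκ]
    simp only [hM]
    rw [mul_div_cancel₀ _ hκ0, sub_self]
  -- orthogonality
  have horth : l2Inner g h = 0 := by
    rw [hg, l2Inner_tensorFun]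
    exact Finset.sum_eq_zero fun x _ => Finset.sum_eq_zero fun i _ => by rw [hsite, mul_zero]
  have horthL : l2Inner g (interchangeLaplacian n A h) = 0 := by
    rw [hg, l2Inner_tensorFun]
    exact Finset.sum_eq_zero fun x _ => Finset.sum_eq_zero fun i _ => by
      rw [siteSum_interchangeLaplacian_eq_zero A hsite, mul_zero]
  have hfg : f = h + g := by rw [hh, sub_add_cancel]
  refine ⟨h, g, hfg, ?_, ?_, gapRW_mul_le_ipDirichlet_tensorFun hA hrow hcol, hsite⟩
  · conv_lhs => rw [hfg]
    rw [l2NormSq_add, l2Inner_re_symm, horth, Complex.zero_re, mul_zero, add_zero]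
  · rw [ipDirichlet_eq_re, ipDirichlet_eq_re, ipDirichlet_eq_re]
    conv_lhs => rw [hfg]
    rw [map_add, l2Inner_add_left, l2Inner_add_right, l2Inner_add_right, horthL,
      l2Inner_interchangeLaplacian_comm A h g, ← conj_l2Inner g, horthL, map_zero, add_zero, zero_add,
      Complex.add_re]

/-- **Block means of `h ∈ 𝓗` vanish**: `∑_e h(blockEmb p e) = N_h(0, p) = 0`. [cite: CaputoLiggettRichthammer2010, §2.4] -/
theorem sum_blockEmb_eq_zero {m : ℕ} {h : Perm (Fin (m + 1)) → ℂ}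
    (hh : ∀ x i : Fin (m + 1), ∑ ω : Perm (Fin (m + 1)) with ω i = x, h ω = 0) (p : Fin (m + 1)) :
    ∑ e : Perm (Fin m), h (blockEmb p e) = 0 := by
  rw [← sum_filter_apply_eq_zero h p, hh]

end Decomposition

/-! ### Network reduction at the vertex `0` (CLR (redrates): `ã_{yz} = a_{y⁺z⁺} + a_{0y⁺}a_{0z⁺}/∑_w a_{0w⁺}`) -/

section Reduction

variable {m : ℕ}

/-- The reduced rates are non-negative. [cite: CaputoLiggettRichthammer2010, §2 (redrates)] -/
theorem redWeights_nonneg {A : Fin (m + 1) → Fin (m + 1) → ℝ} (hA : ∀ x y, 0 ≤ A x y) (y z : Fin m) :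
    0 ≤ A y.succ z.succ + A 0 y.succ * A 0 z.succ / ∑ w : Fin m, A 0 w.succ :=
  add_nonneg (hA _ _) (div_nonneg (mul_nonneg (hA _ _) (hA _ _)) (Finset.sum_nonneg fun _ _ => hA _ _))

/-- Splitting the edge sum of `Fin (m+1)` at the vertex `0`. [folklore] -/
theorem sum_edges_succ {M : Type*} [AddCommMonoid M] (F : Fin (m + 1) → Fin (m + 1) → M) :
    ∑ x : Fin (m + 1), ∑ y : Fin (m + 1) with x < y, F x y =
      ∑ y : Fin m, F 0 y.succ + ∑ x : Fin m, ∑ y : Fin m with x < y, F x.succ y.succ := by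
  rw [Fin.sum_univ_succ]
  congr 1
  · rw [Finset.sum_filter, Fin.sum_univ_succ, if_neg (lt_irrefl _), zero_add]
    exact Finset.sum_congr rfl fun y _ => if_pos (Fin.succ_pos y)
  · refine Finset.sum_congr rfl fun x _ => ?_
    rw [Finset.sum_filter, Finset.sum_filter, Fin.sum_univ_succ, if_neg (Fin.not_lt.mpr (Fin.zero_le _)),
      zero_add]
    exact Finset.sum_congr rfl fun y _ => by simp only [Fin.succ_lt_succ_iff]

/-- **CLR Prop. 2.4 (first half): the reduction bound for the interchange process.** By the octopus
inequality at `0`, `𝓔_A(f) ≥ ∑_p 𝓔^{(m)}_{Ã}(f ∘ blockEmb p)` (`c₀ = ∑_w a_{0w⁺} > 0`).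
[cite: CaputoLiggettRichthammer2010, §2.4 Prop. 2.4 (proof)] -/
theorem sum_ipDirichlet_blocks_le {A : Fin (m + 1) → Fin (m + 1) → ℝ} (hA : ∀ x y, 0 ≤ A x y)
    (hc : 0 < ∑ w : Fin m, A 0 w.succ) (f : Perm (Fin (m + 1)) → ℂ) :
    ∑ p : Fin (m + 1), (∑ x : Fin m, ∑ y : Fin m with x < y, (A x.succ y.succ + A 0 x.succ * A 0 y.succ / ∑ w : Fin m, A 0 w.succ) * (transpDirichlet x y (fun e => f (blockEmb p e)) / 2)) ≤
      (∑ x : Fin (m + 1), ∑ y : Fin (m + 1) with x < y, A x y * (transpDirichlet x y f / 2)) := by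
  have hoct := octopus_inequality m (fun y => A 0 y.succ) (fun y => hA _ _) f
  -- rewrite the block forms through `transpDirichlet_succ_succ`
  have hblocks : ∑ p : Fin (m + 1), (∑ x : Fin m, ∑ y : Fin m with x < y, (A x.succ y.succ + A 0 x.succ * A 0 y.succ / ∑ w : Fin m, A 0 w.succ) * (transpDirichlet x y (fun e => f (blockEmb p e)) / 2)) =
      ∑ x : Fin m, ∑ y : Fin m with x < y,
        (A x.succ y.succ + A 0 x.succ * A 0 y.succ / ∑ w : Fin m, A 0 w.succ) * (transpDirichlet x.succ y.succ f / 2) := by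
    rw [Finset.sum_comm]
    refine Finset.sum_congr rfl fun x _ => ?_
    rw [Finset.sum_comm]
    refine Finset.sum_congr rfl fun y _ => ?_
    rw [transpDirichlet_succ_succ, Finset.sum_div, Finset.mul_sum]
  rw [hblocks, sum_edges_succ]
  -- the octopus inequality, divided by `c₀`
  have hdiv : ∑ x : Fin m, ∑ y : Fin m with x < y,
      A 0 x.succ * A 0 y.succ / (∑ w : Fin m, A 0 w.succ) * (transpDirichlet x.succ y.succ f / 2) ≤
      ∑ y : Fin m, A 0 y.succ * (transpDirichlet 0 y.succ f / 2) := by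
    have h2 : ∑ x : Fin m, ∑ y : Fin m with x < y,
        A 0 x.succ * A 0 y.succ / (∑ w : Fin m, A 0 w.succ) * (transpDirichlet x.succ y.succ f / 2) =
        (∑ x : Fin m, ∑ y : Fin m with x < y, A 0 x.succ * A 0 y.succ * transpDirichlet x.succ y.succ f) /
          (∑ w : Fin m, A 0 w.succ) / 2 := by
      rw [Finset.sum_div, Finset.sum_div]
      refine Finset.sum_congr rfl fun x _ => ?_
      rw [Finset.sum_div, Finset.sum_div]
      refine Finset.sum_congr rfl fun y _ => ?_
      ring
    have h3 : ∑ y : Fin m, A 0 y.succ * (transpDirichlet 0 y.succ f / 2) =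
        (∑ y : Fin m, A 0 y.succ * transpDirichlet 0 y.succ f) / 2 := by
      rw [Finset.sum_div]
      exact Finset.sum_congr rfl fun y _ => by ring
    rw [h2, h3, div_le_div_iff_of_pos_right (by norm_num : (0 : ℝ) < 2), div_le_iff₀ hc, mul_comm]
    exact hoct
  have hsplit : ∀ x : Fin m, ∑ y : Fin m with x < y,
      (A x.succ y.succ + A 0 x.succ * A 0 y.succ / ∑ w : Fin m, A 0 w.succ) * (transpDirichlet x.succ y.succ f / 2) =
      ∑ y : Fin m with x < y, A x.succ y.succ * (transpDirichlet x.succ y.succ f / 2) +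
        ∑ y : Fin m with x < y,
          A 0 x.succ * A 0 y.succ / (∑ w : Fin m, A 0 w.succ) * (transpDirichlet x.succ y.succ f / 2) := by
    intro x
    rw [← Finset.sum_add_distrib]
    exact Finset.sum_congr rfl fun y _ => by ring
  rw [Finset.sum_congr rfl fun x _ => hsplit x, Finset.sum_add_distrib]
  linarith

/-- **CLR Lemma 2.2 (harmonic case): the harmonic extension preserves the Dirichlet form.**
For `ψ` on `Fin m` and `g = (g₀, ψ)` with `g₀ = ∑_y a_{0y⁺} ψ(y)/c₀` harmonic at `0`,
`𝓔^{RW}_A(g) = 𝓔^{RW}_{Ã}(ψ)`. [cite: CaputoLiggettRichthammer2010, §2.1 Lemma 2.2] -/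
theorem rwDirichlet_cons_harmonic {A : Fin (m + 1) → Fin (m + 1) → ℝ} (hc : 0 < ∑ w : Fin m, A 0 w.succ)
    (ψ : Fin m → ℂ) :
    (∑ x : Fin (m + 1), ∑ y : Fin (m + 1) with x < y, A x y *
        ‖(Fin.cons ((∑ y : Fin m, ((A 0 y.succ : ℝ) : ℂ) * ψ y) / ((∑ w : Fin m, A 0 w.succ : ℝ) : ℂ)) ψ : Fin (m + 1) → ℂ) x -
          (Fin.cons ((∑ y : Fin m, ((A 0 y.succ : ℝ) : ℂ) * ψ y) / ((∑ w : Fin m, A 0 w.succ : ℝ) : ℂ)) ψ : Fin (m + 1) → ℂ) y‖ ^ 2) =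
      (∑ x : Fin m, ∑ y : Fin m with x < y, (A x.succ y.succ + A 0 x.succ * A 0 y.succ / ∑ w : Fin m, A 0 w.succ) * ‖ψ x - ψ y‖ ^ 2) := by
  set c : Fin m → ℝ := fun y => A 0 y.succ with hcdef
  set c₀ : ℝ := ∑ w : Fin m, A 0 w.succ with hc₀
  set g₀ : ℂ := (∑ y : Fin m, ((c y : ℝ) : ℂ) * ψ y) / (c₀ : ℂ) with hg₀
  set g : Fin (m + 1) → ℂ := Fin.cons g₀ ψ with hg
  have hg0 : g 0 = g₀ := by simp [hg]
  have hgs : ∀ y : Fin m, g y.succ = ψ y := fun y => by simp [hg]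
  have hc₀C : ((c₀ : ℝ) : ℂ) = ∑ i, ((c i : ℝ) : ℂ) := by
    rw [hc₀, Complex.ofReal_sum]
  have hc0C : ((c₀ : ℝ) : ℂ) ≠ 0 := Complex.ofReal_ne_zero.mpr hc.ne'
  have hharm : ∑ y, ((c y : ℝ) : ℂ) * (ψ y - g₀) = 0 := by
    simp_rw [mul_sub]
    rw [Finset.sum_sub_distrib, ← Finset.sum_mul, ← hc₀C, hg₀, mul_div_cancel₀ _ hc0C, sub_self]
  have hvar : c₀ * ∑ y, c y * ‖g₀ - ψ y‖ ^ 2 =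
      ∑ x : Fin m, ∑ y : Fin m with x < y, c x * c y * ‖ψ x - ψ y‖ ^ 2 := by
    -- expand `∑_{x,y} c_x c_y ‖d_x − d_y‖²` with `d = ψ − g₀`, `∑ c_y d_y = 0`
    set d : Fin m → ℂ := fun y => ψ y - g₀ with hd
    have hd2 : ∀ x y, ‖ψ x - ψ y‖ ^ 2 = ‖d x‖ ^ 2 + ‖d y‖ ^ 2 - 2 * (conj (d x) * d y).re := by
      intro x y
      have : ψ x - ψ y = d x - d y := by simp [hd]
      rw [this]
      have h := l2NormSq_sub (fun _ : Fin 1 => d x) (fun _ : Fin 1 => d y)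
      simp only [l2NormSq, l2Inner, Finset.univ_unique, Finset.sum_singleton, Pi.sub_apply] at h
      exact h
    have hnorm : ∀ y, ‖g₀ - ψ y‖ ^ 2 = ‖d y‖ ^ 2 := fun y => by rw [hd, norm_sub_rev]
    simp_rw [hnorm, hd2]
    have hS := Octopus.sum_sum_eq_sum_prs (fun x y => c x * c y * (‖d x‖ ^ 2 + ‖d y‖ ^ 2 - 2 * (conj (d x) * d y).re))
    -- the full double sum
    have hfull : ∑ x, ∑ y, c x * c y * (‖d x‖ ^ 2 + ‖d y‖ ^ 2 - 2 * (conj (d x) * d y).re) =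
        2 * c₀ * ∑ y, c y * ‖d y‖ ^ 2 := by
      have hcross : ∑ x, ∑ y, c x * c y * (conj (d x) * d y).re = 0 := by
        have : (∑ x, ∑ y, ((c x * c y : ℝ) : ℂ) * (conj (d x) * d y)) =
            conj (∑ x, ((c x : ℝ) : ℂ) * d x) * ∑ y, ((c y : ℝ) : ℂ) * d y := by
          rw [map_sum, Finset.sum_mul_sum]
          refine Finset.sum_congr rfl fun x _ => Finset.sum_congr rfl fun y _ => ?_
          rw [map_mul, Complex.conj_ofReal]
          push_cast
          ring
        have hz : ∑ y, ((c y : ℝ) : ℂ) * d y = 0 := by simpa [hd] using hharm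
        rw [hz, mul_zero] at this
        have := congrArg Complex.re this
        rw [Complex.re_sum, Complex.zero_re] at this
        rw [← this]
        refine Finset.sum_congr rfl fun x _ => ?_
        rw [Complex.re_sum]
        refine Finset.sum_congr rfl fun y _ => ?_
        rw [Complex.re_ofReal_mul]
      have h1 : ∑ x, ∑ y, c x * c y * (‖d x‖ ^ 2 + ‖d y‖ ^ 2 - 2 * (conj (d x) * d y).re) =
          ∑ x, ∑ y, (c x * c y * ‖d x‖ ^ 2 + c x * c y * ‖d y‖ ^ 2) -
            2 * ∑ x, ∑ y, c x * c y * (conj (d x) * d y).re := by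
        rw [Finset.mul_sum, ← Finset.sum_sub_distrib]
        refine Finset.sum_congr rfl fun x _ => ?_
        rw [Finset.mul_sum, ← Finset.sum_sub_distrib]
        refine Finset.sum_congr rfl fun y _ => ?_
        ring
      rw [h1, hcross, mul_zero, sub_zero]
      have h2 : ∑ x, ∑ y, (c x * c y * ‖d x‖ ^ 2 + c x * c y * ‖d y‖ ^ 2) =
          (∑ x, c x * ‖d x‖ ^ 2) * c₀ + c₀ * ∑ y, c y * ‖d y‖ ^ 2 := by
        have hc₀' : ∑ y, c y = c₀ := by rw [hc₀]
        simp_rw [Finset.sum_add_distrib]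
        congr 1
        · rw [Finset.sum_mul]
          refine Finset.sum_congr rfl fun x _ => ?_
          rw [show (∑ y, c x * c y * ‖d x‖ ^ 2) = ∑ y, c x * ‖d x‖ ^ 2 * c y from
            Finset.sum_congr rfl fun y _ => by ring, ← Finset.mul_sum, hc₀']
        · rw [Finset.sum_comm, Finset.mul_sum]
          refine Finset.sum_congr rfl fun y _ => ?_
          rw [show (∑ x, c x * c y * ‖d y‖ ^ 2) = ∑ x, c y * ‖d y‖ ^ 2 * c x from
            Finset.sum_congr rfl fun x _ => by ring, ← Finset.mul_sum, hc₀']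
          ring
      rw [h2]
      ring
    -- the diagonal and the symmetry of the off-diagonal part
    have hdiag : ∑ u, c u * c u * (‖d u‖ ^ 2 + ‖d u‖ ^ 2 - 2 * (conj (d u) * d u).re) = 0 := by
      refine Finset.sum_eq_zero fun u _ => ?_
      rw [Complex.conj_mul', ← Complex.ofReal_pow, Complex.ofReal_re]
      ring
    have hsymm : ∑ p ∈ Octopus.prs m, c p.2 * c p.1 * (‖d p.2‖ ^ 2 + ‖d p.1‖ ^ 2 - 2 * (conj (d p.2) * d p.1).re) =
        ∑ p ∈ Octopus.prs m, c p.1 * c p.2 * (‖d p.1‖ ^ 2 + ‖d p.2‖ ^ 2 - 2 * (conj (d p.1) * d p.2).re) := by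
      refine Finset.sum_congr rfl fun p _ => ?_
      have : (conj (d p.2) * d p.1).re = (conj (d p.1) * d p.2).re := by
        rw [← Complex.conj_re (conj (d p.1) * d p.2), map_mul, Complex.conj_conj, mul_comm]
      rw [this]
      ring
    rw [hdiag, add_zero, hsymm, ← two_mul, Octopus.sum_prs] at hS
    have hS' : ∑ x : Fin m, ∑ y : Fin m with x < y, c x * c y * (‖d x‖ ^ 2 + ‖d y‖ ^ 2 - 2 * (conj (d x) * d y).re) =
        c₀ * ∑ y, c y * ‖d y‖ ^ 2 := by linarith
    rw [hS']
  -- assemble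
  change (∑ x : Fin (m + 1), ∑ y : Fin (m + 1) with x < y, A x y * ‖g x - g y‖ ^ 2) = _
  rw [sum_edges_succ]
  simp only [hg0, hgs]
  have hfirst : ∑ y : Fin m, A 0 y.succ * ‖g₀ - ψ y‖ ^ 2 =
      ∑ x : Fin m, ∑ y : Fin m with x < y, c x * c y / c₀ * ‖ψ x - ψ y‖ ^ 2 := by
    have := hvar
    rw [← div_left_inj' hc.ne'] at this
    rw [mul_div_cancel_left₀ _ hc.ne'] at this
    rw [show (fun y => A 0 y.succ) = c from rfl] at *
    rw [this, Finset.sum_div]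
    refine Finset.sum_congr rfl fun x _ => ?_
    rw [Finset.sum_div]
    refine Finset.sum_congr rfl fun y _ => ?_
    ring
  rw [show (∑ y : Fin m, A 0 y.succ * ‖g₀ - ψ y‖ ^ 2) = ∑ y : Fin m, A 0 y.succ * ‖g₀ - ψ y‖ ^ 2 from rfl,
    hfirst, ← Finset.sum_add_distrib]
  refine Finset.sum_congr rfl fun x _ => ?_
  rw [← Finset.sum_add_distrib]
  refine Finset.sum_congr rfl fun y _ => ?_
  rw [hcdef, hc₀]
  ring

/-- **CLR Prop. 2.1: the random-walk gap does not decrease under reduction**,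
`λ₁^{RW}(Ã) ≥ λ₁^{RW}(A)` (`m ≥ 2`, `c₀ > 0`). [cite: CaputoLiggettRichthammer2010, §2.1 Prop. 2.1] -/
theorem gapRW_le_gapRW_red (hm : 2 ≤ m) {A : Fin (m + 1) → Fin (m + 1) → ℝ} (hA : ∀ x y, 0 ≤ A x y)
    (hc : 0 < ∑ w : Fin m, A 0 w.succ) :
    sInf ((fun φ : Fin (m + 1) → ℂ => (∑ x : Fin (m + 1), ∑ y : Fin (m + 1) with x < y, A x y * ‖φ x - φ y‖ ^ 2) / l2NormSq φ) '' {φ : Fin (m + 1) → ℂ | ∑ x, φ x = 0 ∧ φ ≠ 0}) ≤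
      sInf ((fun φ : Fin m → ℂ => (∑ x : Fin m, ∑ y : Fin m with x < y, (A x.succ y.succ + A 0 x.succ * A 0 y.succ / ∑ w : Fin m, A 0 w.succ) * ‖φ x - φ y‖ ^ 2) / l2NormSq φ) '' {φ : Fin m → ℂ | ∑ x, φ x = 0 ∧ φ ≠ 0}) := by
  refine le_gapRW hm fun ψ hψ hψ0 => ?_
  rw [le_div_iff₀ ((l2NormSq_pos_iff ψ).mpr hψ0)]
  -- harmonic extension and recentring
  set g₀ : ℂ := (∑ y : Fin m, ((A 0 y.succ : ℝ) : ℂ) * ψ y) / ((∑ w : Fin m, A 0 w.succ : ℝ) : ℂ) with hg₀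
  set g : Fin (m + 1) → ℂ := Fin.cons g₀ ψ with hg
  set μ : ℂ := (∑ v, g v) / ((m + 1 : ℕ) : ℂ) with hμ
  set φ : Fin (m + 1) → ℂ := fun v => g v - μ with hφ
  have hm1 : ((m + 1 : ℕ) : ℂ) ≠ 0 := by exact_mod_cast Nat.succ_ne_zero m
  have hφsum : ∑ v, φ v = 0 := by
    simp only [hφ, Finset.sum_sub_distrib, Finset.sum_const, Finset.card_univ, Fintype.card_fin,
      nsmul_eq_mul, hμ]
    rw [mul_div_cancel₀ _ hm1, sub_self]
  have hgap := gapRW_mul_le hA hφsum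
  have hDφ : (∑ x : Fin (m + 1), ∑ y : Fin (m + 1) with x < y, A x y * ‖φ x - φ y‖ ^ 2) =
      (∑ x : Fin m, ∑ y : Fin m with x < y, (A x.succ y.succ + A 0 x.succ * A 0 y.succ / ∑ w : Fin m, A 0 w.succ) * ‖ψ x - ψ y‖ ^ 2) := by
    simp only [hφ, sub_sub_sub_cancel_right]
    rw [hg, hg₀]
    exact rwDirichlet_cons_harmonic hc ψ
  -- `‖φ‖² ≥ ‖ψ‖²`
  have hnorm : l2NormSq ψ ≤ l2NormSq φ := by
    rw [l2NormSq, l2NormSq, Fin.sum_univ_succ]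
    have hdrop : ∑ y : Fin m, ‖ψ y‖ ^ 2 ≤ ∑ y : Fin m, ‖φ y.succ‖ ^ 2 := by
      have hexp : ∑ y : Fin m, ‖φ y.succ‖ ^ 2 = ∑ y : Fin m, ‖ψ y‖ ^ 2 + m * ‖μ‖ ^ 2 := by
        have h1 : ∀ y : Fin m, φ y.succ = ψ y - μ := fun y => by simp [hφ, hg]
        simp_rw [h1]
        have h2 := l2NormSq_sub ψ (fun _ => μ)
        simp only [l2NormSq, l2Inner, Pi.sub_apply, Finset.sum_const, Finset.card_univ, Fintype.card_fin,
          nsmul_eq_mul] at h2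
        rw [← Finset.sum_mul, ← map_sum, hψ, map_zero, zero_mul, Complex.zero_re, mul_zero, sub_zero] at h2
        rw [h2]
      rw [hexp]
      nlinarith [norm_nonneg μ]
    nlinarith [norm_nonneg (φ 0)]
  calc sInf ((fun φ : Fin (m + 1) → ℂ => (∑ x : Fin (m + 1), ∑ y : Fin (m + 1) with x < y, A x y * ‖φ x - φ y‖ ^ 2) / l2NormSq φ) '' {φ : Fin (m + 1) → ℂ | ∑ x, φ x = 0 ∧ φ ≠ 0}) * l2NormSq ψ
      ≤ sInf ((fun φ : Fin (m + 1) → ℂ => (∑ x : Fin (m + 1), ∑ y : Fin (m + 1) with x < y, A x y * ‖φ x - φ y‖ ^ 2) / l2NormSq φ) '' {φ : Fin (m + 1) → ℂ | ∑ x, φ x = 0 ∧ φ ≠ 0}) * l2NormSq φ :=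
        mul_le_mul_of_nonneg_left hnorm (gapRW_nonneg hA)
    _ ≤ (∑ x : Fin (m + 1), ∑ y : Fin (m + 1) with x < y, A x y * ‖φ x - φ y‖ ^ 2) := hgap
    _ = _ := hDφ

end Reduction

/-! ### The recursion (CLR §2.4) -/

section Recursion

/-- **The base case `n = 2`** ("when `n = 2`, the random walk and the interchange process are the
same 2-state Markov chain"). [cite: CaputoLiggettRichthammer2010, §2.4] -/
theorem gap_two (A : Fin 2 → Fin 2 → ℝ) (hA : ∀ x y, 0 ≤ A x y) (f : Perm (Fin 2) → ℂ)
    (hf : ∑ τ, f τ = 0) :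
    sInf ((fun φ : Fin 2 → ℂ => (∑ x : Fin 2, ∑ y : Fin 2 with x < y, A x y * ‖φ x - φ y‖ ^ 2) / l2NormSq φ) '' {φ : Fin 2 → ℂ | ∑ x, φ x = 0 ∧ φ ≠ 0}) * l2NormSq f ≤
      (∑ x : Fin 2, ∑ y : Fin 2 with x < y, A x y * (transpDirichlet x y f / 2)) := by
  have huniv : (Finset.univ : Finset (Perm (Fin 2))) = {1, swap 0 1} := by decide
  have hne : (1 : Perm (Fin 2)) ≠ swap 0 1 := by decide
  have hss : swap (0 : Fin 2) 1 * swap 0 1 = 1 := swap_mul_self 0 1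
  -- the one-particle function `φ x = f(σ_x)`
  set φ : Fin 2 → ℂ := ![f 1, f (swap 0 1)] with hφ
  have hφsum : ∑ x, φ x = 0 := by
    rw [Fin.sum_univ_two]
    simp only [hφ, Matrix.cons_val_zero, Matrix.cons_val_one]
    rw [← hf, huniv, Finset.sum_insert (by simp [hne]), Finset.sum_singleton]
  have hnorm : l2NormSq φ = l2NormSq f := by
    rw [l2NormSq, l2NormSq, Fin.sum_univ_two, huniv, Finset.sum_insert (by simp [hne]), Finset.sum_singleton]
    simp [hφ]
  have hD : (∑ x : Fin 2, ∑ y : Fin 2 with x < y, A x y * ‖φ x - φ y‖ ^ 2) =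
      (∑ x : Fin 2, ∑ y : Fin 2 with x < y, A x y * (transpDirichlet x y f / 2)) := by
    rw [Fin.sum_univ_two, Fin.sum_univ_two]
    have e1 : (Finset.univ.filter fun y : Fin 2 => (0 : Fin 2) < y) = {1} := by decide
    have e2 : (Finset.univ.filter fun y : Fin 2 => (1 : Fin 2) < y) = ∅ := by decide
    rw [e1, e2, Finset.sum_singleton, Finset.sum_singleton, Finset.sum_empty, Finset.sum_empty, add_zero,
      add_zero, transpDirichlet, huniv, Finset.sum_insert (by simp [hne]), Finset.sum_singleton, mul_one, hss]
    simp only [hφ, Matrix.cons_val_zero, Matrix.cons_val_one]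
    rw [norm_sub_rev (f (swap 0 1)) (f 1)]
    ring
  rw [← hnorm, ← hD]
  exact gapRW_mul_le hA hφsum

/-- **The Caputo–Liggett–Richthammer theorem (spectral-gap form of Theorem 1.1):**
for every `n`, all non-negative rates `A` on `Fin n` and every `f : 𝔖ₙ → ℂ` with `∑_τ f(τ) = 0`,
`λ₁^{RW}(A) · ‖f‖² ≤ 𝓔_A(f) = ½ ∑_{x<y} a_{xy} ∑_τ ‖f((xy)τ) − f(τ)‖²`, where
`λ₁^{RW}(A) = inf {∑_{x<y} a_{xy}‖φ x − φ y‖²/‖φ‖² : ∑ φ = 0, φ ≠ 0}`,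
i.e. `λ₁^{IP}(G) ≥ λ₁^{RW}(G)` ("for all weighted graphs `G`, the interchange process and the random
walk have the same spectral gap"; the easy converse `λ₁^{IP} ≤ λ₁^{RW}` is (ineq) of CLR §1.2.2).
Proof: CLR's recursion §2.4 via `sum_ipDirichlet_blocks_le` (octopus inequality),
`gapRW_le_gapRW_red` (Prop. 2.1) and the orthogonal decomposition `exists_decomp`.
[cite: CaputoLiggettRichthammer2010, Theorem 1.1] -/
theorem clr_spectralGap (n : ℕ) (A : Fin n → Fin n → ℝ) (hA : ∀ x y, 0 ≤ A x y)
    (f : Perm (Fin n) → ℂ) (hf : ∑ τ, f τ = 0) :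
    sInf ((fun φ : Fin n → ℂ => (∑ x : Fin n, ∑ y : Fin n with x < y, A x y * ‖φ x - φ y‖ ^ 2) / l2NormSq φ) '' {φ : Fin n → ℂ | ∑ x, φ x = 0 ∧ φ ≠ 0}) * l2NormSq f ≤
      (∑ x : Fin n, ∑ y : Fin n with x < y, A x y * (transpDirichlet x y f / 2)) := by
  induction n with
  | zero =>
    -- `𝔖₀` is trivial: `f = 0`
    have hone : ∀ τ : Perm (Fin 0), τ = 1 := by
      have hcard : Fintype.card (Perm (Fin 0)) = 1 := by rw [Fintype.card_perm, Fintype.card_fin]; rfl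
      obtain ⟨x, hx⟩ := Fintype.card_eq_one_iff.mp hcard
      intro τ
      rw [hx τ, hx 1]
    have : f = 0 := by
      funext τ
      rw [hone τ]
      have huniv : (Finset.univ : Finset (Perm (Fin 0))) = {1} := by
        ext τ; simp [hone τ]
      rw [huniv, Finset.sum_singleton] at hf
      rw [hf, Pi.zero_apply]
    rw [this, l2NormSq_zero, mul_zero]
    exact ipDirichlet_nonneg hA 0
  | succ m ih =>
    rcases Nat.lt_or_ge m 2 with hm | hm
    · interval_cases m
      · -- `n = 1`
        have hone : ∀ τ : Perm (Fin (0 + 1)), τ = 1 := by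
          have hcard : Fintype.card (Perm (Fin (0 + 1))) = 1 := by
            rw [Fintype.card_perm, Fintype.card_fin]; rfl
          obtain ⟨x, hx⟩ := Fintype.card_eq_one_iff.mp hcard
          intro τ
          rw [hx τ, hx 1]
        have : f = 0 := by
          funext τ
          rw [hone τ]
          have huniv : (Finset.univ : Finset (Perm (Fin (0 + 1)))) = {1} := by
            ext τ; simp [hone τ]
          rw [huniv, Finset.sum_singleton] at hf
          rw [hf, Pi.zero_apply]
        rw [this, l2NormSq_zero, mul_zero]
        exact ipDirichlet_nonneg hA 0
      · exact gap_two A hA f hf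
    · -- the recursive step, `n = m + 1 ≥ 3`
      by_cases hc : ∑ w : Fin m, A 0 w.succ = 0
      · -- vertex `0` is isolated: the gap vanishes
        have h0 : ∀ y : Fin m, A 0 y.succ = 0 := fun y =>
          (Finset.sum_eq_zero_iff_of_nonneg (fun y _ => hA 0 (Fin.succ y))).mp hc y (Finset.mem_univ y)
        rw [gapRW_eq_zero_of_isolated (by omega) hA h0, zero_mul]
        exact ipDirichlet_nonneg hA f
      · have hcpos : 0 < ∑ w : Fin m, A 0 w.succ :=
          lt_of_le_of_ne (Finset.sum_nonneg fun y _ => hA _ _) (Ne.symm hc)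
        -- decompose `f = h + g`
        obtain ⟨h, g, -, hnorm, hE, hg, hh⟩ := exists_decomp A hA f hf
        rw [hnorm, hE, mul_add]
        refine add_le_add ?_ hg
        -- the many-particle part: blocks, induction hypothesis on the reduced network, Prop. 2.1
        have hA' : ∀ y z : Fin m, 0 ≤ A y.succ z.succ + A 0 y.succ * A 0 z.succ / ∑ w : Fin m, A 0 w.succ :=
          redWeights_nonneg hA
        have hblocks : sInf ((fun φ : Fin m → ℂ => (∑ x : Fin m, ∑ y : Fin m with x < y, (A x.succ y.succ + A 0 x.succ * A 0 y.succ / ∑ w : Fin m, A 0 w.succ) * ‖φ x - φ y‖ ^ 2) / l2NormSq φ) '' {φ : Fin m → ℂ | ∑ x, φ x = 0 ∧ φ ≠ 0}) * l2NormSq h ≤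
            ∑ p : Fin (m + 1), (∑ x : Fin m, ∑ y : Fin m with x < y, (A x.succ y.succ + A 0 x.succ * A 0 y.succ / ∑ w : Fin m, A 0 w.succ) * (transpDirichlet x y (fun e => h (blockEmb p e)) / 2)) := by
          rw [l2NormSq_eq_sum_blocks, Finset.mul_sum]
          refine Finset.sum_le_sum fun p _ => ?_
          exact ih (fun y z : Fin m => A y.succ z.succ + A 0 y.succ * A 0 z.succ / ∑ w : Fin m, A 0 w.succ) hA'
            (fun e => h (blockEmb p e)) (sum_blockEmb_eq_zero hh p)
        calc sInf ((fun φ : Fin (m + 1) → ℂ => (∑ x : Fin (m + 1), ∑ y : Fin (m + 1) with x < y, A x y * ‖φ x - φ y‖ ^ 2) / l2NormSq φ) '' {φ : Fin (m + 1) → ℂ | ∑ x, φ x = 0 ∧ φ ≠ 0}) * l2NormSq h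
            ≤ sInf ((fun φ : Fin m → ℂ => (∑ x : Fin m, ∑ y : Fin m with x < y, (A x.succ y.succ + A 0 x.succ * A 0 y.succ / ∑ w : Fin m, A 0 w.succ) * ‖φ x - φ y‖ ^ 2) / l2NormSq φ) '' {φ : Fin m → ℂ | ∑ x, φ x = 0 ∧ φ ≠ 0}) * l2NormSq h :=
              mul_le_mul_of_nonneg_right (gapRW_le_gapRW_red hm hA hcpos) (l2NormSq_nonneg h)
          _ ≤ ∑ p : Fin (m + 1), (∑ x : Fin m, ∑ y : Fin m with x < y, (A x.succ y.succ + A 0 x.succ * A 0 y.succ / ∑ w : Fin m, A 0 w.succ) * (transpDirichlet x y (fun e => h (blockEmb p e)) / 2)) := hblocks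
          _ ≤ _ := sum_ipDirichlet_blocks_le hA hcpos h

/-- **Theorem 1.1 in the tree's notation**: `λ₁^{RW}(A) ≤ rayleighQuotient n A f` for every non-zero
`f : 𝔖ₙ → ℂ` with `∑ f = 0` (the Rayleigh quotient of the interchange Laplacian of
`AldousLambdaOne.lean`). [cite: CaputoLiggettRichthammer2010, Theorem 1.1] -/
theorem gapRW_le_rayleighQuotient {n : ℕ} (A : Fin n → Fin n → ℝ) (hA : ∀ x y, 0 ≤ A x y)
    {f : Perm (Fin n) → ℂ} (hf : ∑ τ, f τ = 0) (hf0 : f ≠ 0) :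
    sInf ((fun φ : Fin n → ℂ => (∑ x : Fin n, ∑ y : Fin n with x < y, A x y * ‖φ x - φ y‖ ^ 2) / l2NormSq φ) '' {φ : Fin n → ℂ | ∑ x, φ x = 0 ∧ φ ≠ 0}) ≤ rayleighQuotient n A f := by
  rw [rayleighQuotient_eq, le_div_iff₀ ((l2NormSq_pos_iff f).mpr hf0)]
  exact clr_spectralGap n A hA f hf

end Recursion

end Literature.RepresentationTheory.FiniteGroups

end
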